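import Mathlib
import Literature.AlgebraicGeometry.Resolution.WeightedInitialTerms
import HarnessLib

/-!
# Refining a representation to a unit representative while protecting a monomial

Topic: `Literature/AlgebraicGeometry/Resolution`. A bookkeeping tool behind the computation of
the polygon after a dissolution at a non-rational point (Cossart–Jannsen–Saito, LNM 2270, proof of
Lemma 14.8, (14.24)–(14.26): "(14.24) shows that there is a vertex of `Δ(f′, z′, (u₁, φ′))` on the
line `a₁ = δ − 1`"): a representation `g ≡ Q(c) mod 𝔪^K` with ARBITRARY coefficients is refined
to one with unit coefficients by re-expanding the non-unit coefficients through `𝔪 = (c)`; a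
monomial `M₀` of `Q` with a unit coefficient and without predecessors (no `m ∈ supp Q` with
`m < M₀` componentwise) keeps its coefficient. PROVED (no facts):

* `refineStep` — one round of re-expansion; `eval_refineStep`, `coeff_refineStep_of_noPred`;
* `exists_unitRep_mem_support` — **a unit representative modulo `𝔪^K` containing `M₀`**.

## Sources

* V. Cossart, U. Jannsen, S. Saito, LNM 2270 (2020), Ch. 7 (7.3); proof of Lemma 14.8.
  [CossartJannsenSaito2020]
-/

noncomputable section

open IsLocalRing MvPolynomial

namespace Literature.AlgebraicGeometry.Resolution

universe u

section Refine

variable {R : Type u} [CommRing R] [IsLocalRing R] (c : Fin 3 → R)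
  (hgenr : Ideal.span (Set.range c) = maximalIdeal R)

/-- A monomial `m` is a predecessor of `M₀` if `m ≤ M₀` componentwise and `m ≠ M₀`. [folklore] -/
def IsPred (m M₀ : Fin 3 →₀ ℕ) : Prop := m ≤ M₀ ∧ m ≠ M₀

include hgenr in
/-- Non-units are combinations of the parameters. [folklore] -/
theorem exists_eq_sum_mul_of_not_isUnit {a : R} (ha : ¬ IsUnit a) :
    ∃ b : Fin 3 → R, a = ∑ i, b i * c i := by
  have : a ∈ Ideal.span (Set.range c) := by rw [hgenr]; exact (mem_maximalIdeal _).mpr ha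
  obtain ⟨b, hb⟩ := Ideal.mem_span_range_iff_exists_fun.mp this
  exact ⟨b, hb.symm⟩

open scoped Classical in
/-- **One refinement round**: keep the unit-coefficient terms, and replace each non-unit
coefficient `a_m = Σ bᵢ cᵢ` by the terms `bᵢ X^{m + eᵢ}`. [cite: CossartJannsenSaito2020, Ch. 7 (7.3)] -/
def refineStep (b : (Fin 3 →₀ ℕ) → Fin 3 → R) (Q : MvPolynomial (Fin 3) R) : MvPolynomial (Fin 3) R :=
  (∑ m ∈ Q.support.filter (fun m => IsUnit (Q.coeff m)), monomial m (Q.coeff m)) +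
    ∑ m ∈ Q.support.filter (fun m => ¬ IsUnit (Q.coeff m)), ∑ i, monomial (m + Finsupp.single i 1) (b m i)

omit [IsLocalRing R] in
/-- Evaluation is unchanged when `b` decomposes the non-unit coefficients. [folklore] -/
theorem eval_refineStep {b : (Fin 3 →₀ ℕ) → Fin 3 → R} {Q : MvPolynomial (Fin 3) R}
    (hb : ∀ m ∈ Q.support, ¬ IsUnit (Q.coeff m) → Q.coeff m = ∑ i, b m i * c i) :
    eval c (refineStep b Q) = eval c Q := by
  classical
  rw [refineStep, map_add, map_sum, map_sum]
  conv_rhs => rw [Q.as_sum, map_sum, ← Finset.sum_filter_add_sum_filter_not Q.support (fun m => IsUnit (Q.coeff m))]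
  congr 1
  refine Finset.sum_congr rfl fun m hm => ?_
  obtain ⟨hms, hnu⟩ := Finset.mem_filter.mp hm
  rw [map_sum, eval_monomial_eq_monom3, hb m hms hnu, Finset.sum_mul]
  refine Finset.sum_congr rfl fun i _ => ?_
  rw [eval_monomial_eq_monom3, monom3_add]
  have : monom3 c (Finsupp.single i 1) = c i := by
    fin_cases i <;> simp [monom3]
  rw [this]; ring

open scoped Classical in
/-- Coefficients after one round. [folklore] -/
theorem coeff_refineStep (b : (Fin 3 →₀ ℕ) → Fin 3 → R) (Q : MvPolynomial (Fin 3) R) (μ' : Fin 3 →₀ ℕ) :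
    (refineStep b Q).coeff μ' =
      (if IsUnit (Q.coeff μ') then Q.coeff μ' else 0) +
        ∑ m ∈ Q.support.filter (fun m => ¬ IsUnit (Q.coeff m)),
          ∑ i, if m + Finsupp.single i 1 = μ' then b m i else 0 := by
  classical
  rw [refineStep, coeff_add, coeff_sum, coeff_sum]
  congr 1
  · by_cases hu : IsUnit (Q.coeff μ')
    · rw [if_pos hu]
      have hμs : μ' ∈ Q.support := by
        rw [mem_support_iff]; intro h0; rw [h0] at hu; exact not_isUnit_zero hu
      rw [Finset.sum_eq_single μ']
      · rw [coeff_monomial, if_pos rfl]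
      · intro m _ hne; rw [coeff_monomial, if_neg hne]
      · intro h; exact absurd (Finset.mem_filter.mpr ⟨hμs, hu⟩) h
    · rw [if_neg hu]
      refine Finset.sum_eq_zero fun m hm => ?_
      rw [coeff_monomial, if_neg]
      rintro rfl; exact hu (Finset.mem_filter.mp hm).2
  · refine Finset.sum_congr rfl fun m _ => ?_
    rw [coeff_sum]
    refine Finset.sum_congr rfl fun i _ => ?_
    rw [coeff_monomial]

/-- **The protected monomial keeps its coefficient** when it has no predecessor among the
non-unit terms. [folklore] -/
theorem coeff_refineStep_of_noPred (b : (Fin 3 →₀ ℕ) → Fin 3 → R) {Q : MvPolynomial (Fin 3) R}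
    {M₀ : Fin 3 →₀ ℕ} (hnp : ∀ m ∈ Q.support, ¬ IsUnit (Q.coeff m) → ¬ IsPred m M₀)
    (hu : IsUnit (Q.coeff M₀)) : (refineStep b Q).coeff M₀ = Q.coeff M₀ := by
  classical
  rw [coeff_refineStep, if_pos hu, add_eq_left]
  refine Finset.sum_eq_zero fun m hm => Finset.sum_eq_zero fun i _ => ?_
  rw [if_neg]
  intro h
  obtain ⟨hms, hnu⟩ := Finset.mem_filter.mp hm
  apply hnp m hms hnu
  refine ⟨?_, ?_⟩
  · rw [← h]; exact le_self_add
  · rintro rfl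
    have := congrArg (fun e => e i) h
    simp at this

/-- Support of a refinement round. [folklore] -/
theorem support_refineStep_subset (b : (Fin 3 →₀ ℕ) → Fin 3 → R) (Q : MvPolynomial (Fin 3) R)
    {μ' : Fin 3 →₀ ℕ} (hμ' : μ' ∈ (refineStep b Q).support) :
    (μ' ∈ Q.support ∧ IsUnit (Q.coeff μ')) ∨
      ∃ m ∈ Q.support, ¬ IsUnit (Q.coeff m) ∧ ∃ i, m + Finsupp.single i 1 = μ' := by
  classical
  rw [mem_support_iff, coeff_refineStep] at hμ'
  by_cases hu : IsUnit (Q.coeff μ')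
  · left
    exact ⟨mem_support_iff.mpr fun h0 => not_isUnit_zero (h0 ▸ hu), hu⟩
  · right
    rw [if_neg hu, zero_add] at hμ'
    obtain ⟨m, hm, hne⟩ := Finset.exists_ne_zero_of_sum_ne_zero hμ'
    obtain ⟨i, -, hi⟩ := Finset.exists_ne_zero_of_sum_ne_zero hne
    obtain ⟨hms, hnu⟩ := Finset.mem_filter.mp hm
    refine ⟨m, hms, hnu, i, ?_⟩
    by_contra h; rw [if_neg h] at hi; exact hi rfl

omit [IsLocalRing R] in
/-- Monomials of degree `n` lie in `(c)^n`. [folklore] -/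
theorem monom3_mem_span_pow_degree (m : Fin 3 →₀ ℕ) :
    monom3 c m ∈ Ideal.span (Set.range c) ^ m.degree := by
  rw [monom3, Finsupp.degree_eq_sum, Fin.sum_univ_three, pow_add, pow_add]
  have hc : ∀ i, c i ∈ Ideal.span (Set.range c) := fun i => Ideal.subset_span ⟨i, rfl⟩
  exact Ideal.mul_mem_mul (Ideal.mul_mem_mul (Ideal.pow_mem_pow (hc 0) _) (Ideal.pow_mem_pow (hc 1) _))
    (Ideal.pow_mem_pow (hc 2) _)

include hgenr in
/-- The auxiliary induction: `d` rounds remain. [folklore] -/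
theorem exists_unitRep_mem_support_aux {g : R} {K : ℕ} {M₀ : Fin 3 →₀ ℕ} :
    ∀ (d : ℕ) (Q : MvPolynomial (Fin 3) R), g - eval c Q ∈ maximalIdeal R ^ K →
      IsUnit (Q.coeff M₀) → (∀ m ∈ Q.support, ¬ IsPred m M₀) →
      (∀ m ∈ Q.support, ¬ IsUnit (Q.coeff m) → K ≤ m.degree + d) →
      ∃ G : MvPolynomial (Fin 3) R, HasUnitCoeffs G ∧ g - eval c G ∈ maximalIdeal R ^ K ∧
        G.coeff M₀ = Q.coeff M₀ := by
  classical
  intro d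
  induction d with
  | zero =>
    intro Q hQ hu hnp hdeg
    -- drop the non-unit terms: they have degree `≥ K`
    refine ⟨∑ m ∈ Q.support.filter (fun m => IsUnit (Q.coeff m)), monomial m (Q.coeff m), ?_, ?_, ?_⟩
    · intro m hm
      rw [mem_support_iff] at hm
      rw [coeff_sum] at hm ⊢
      have key : ∀ m' ∈ Q.support.filter (fun m => IsUnit (Q.coeff m)),
          coeff m (monomial m' (Q.coeff m')) = if m' = m then Q.coeff m' else 0 := fun m' _ => by
        rw [coeff_monomial]
      rw [Finset.sum_congr rfl key, Finset.sum_ite_eq'] at hm ⊢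
      split_ifs at hm ⊢ with h
      · exact (Finset.mem_filter.mp h).2
      · exact absurd rfl hm
    · have hsplit : eval c Q = eval c (∑ m ∈ Q.support.filter (fun m => IsUnit (Q.coeff m)), monomial m (Q.coeff m)) +
          ∑ m ∈ Q.support.filter (fun m => ¬ IsUnit (Q.coeff m)), Q.coeff m * monom3 c m := by
        conv_lhs => rw [Q.as_sum, map_sum, ← Finset.sum_filter_add_sum_filter_not Q.support (fun m => IsUnit (Q.coeff m))]
        rw [map_sum]
        congr 1
        refine Finset.sum_congr rfl fun m _ => ?_
        rw [eval_monomial_eq_monom3]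
      have : g - eval c (∑ m ∈ Q.support.filter (fun m => IsUnit (Q.coeff m)), monomial m (Q.coeff m)) =
          (g - eval c Q) + ∑ m ∈ Q.support.filter (fun m => ¬ IsUnit (Q.coeff m)), Q.coeff m * monom3 c m := by
        rw [hsplit]; ring
      rw [this]
      refine Ideal.add_mem _ hQ (Ideal.sum_mem _ fun m hm => Ideal.mul_mem_left _ _ ?_)
      obtain ⟨hms, hnu⟩ := Finset.mem_filter.mp hm
      have hK : K ≤ m.degree := by have := hdeg m hms hnu; omega
      rw [← hgenr]
      exact Ideal.pow_le_pow_right hK (monom3_mem_span_pow_degree c m)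
    · rw [coeff_sum]
      have key : ∀ m' ∈ Q.support.filter (fun m => IsUnit (Q.coeff m)),
          coeff M₀ (monomial m' (Q.coeff m')) = if m' = M₀ then Q.coeff m' else 0 := fun m' _ => by
        rw [coeff_monomial]
      rw [Finset.sum_congr rfl key, Finset.sum_ite_eq', if_pos]
      exact Finset.mem_filter.mpr ⟨mem_support_iff.mpr hu.ne_zero, hu⟩
  | succ d ih =>
    intro Q hQ hu hnp hdeg
    -- decompose the non-unit coefficients and refine once
    have hb : ∀ m, ∃ b : Fin 3 → R, ¬ IsUnit (Q.coeff m) → Q.coeff m = ∑ i, b i * c i := by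
      intro m
      by_cases h : IsUnit (Q.coeff m)
      · exact ⟨0, fun h' => absurd h h'⟩
      · obtain ⟨b, hb⟩ := exists_eq_sum_mul_of_not_isUnit c hgenr h
        exact ⟨b, fun _ => hb⟩
    choose b hb using hb
    set Q' := refineStep b Q with hQ'
    have hev : eval c Q' = eval c Q := eval_refineStep c (fun m _ h => hb m h)
    have hnp' : ∀ m ∈ Q.support, ¬ IsUnit (Q.coeff m) → ¬ IsPred m M₀ := fun m hm _ => hnp m hm
    have hcoeff : Q'.coeff M₀ = Q.coeff M₀ := coeff_refineStep_of_noPred b hnp' hu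
    have hnpQ' : ∀ m ∈ Q'.support, ¬ IsPred m M₀ := by
      -- no predecessor in the new support
      intro μ' hμ' hpred
      rcases support_refineStep_subset b Q hμ' with ⟨hμs, -⟩ | ⟨m, hms, -, i, hi⟩
      · exact hnp μ' hμs hpred
      · apply hnp m hms
        refine ⟨?_, ?_⟩
        · exact le_trans (by rw [← hi]; exact le_self_add) hpred.1
        · rintro rfl
          have h1 : m + Finsupp.single i 1 ≤ m := by rw [hi]; exact hpred.1
          have := h1 i
          simp at this
    have hdegQ' : ∀ m ∈ Q'.support, ¬ IsUnit (Q'.coeff m) → K ≤ m.degree + d := by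
      -- degrees of the non-unit terms went up
      intro μ' hμ' hnu'
      rw [mem_support_iff, coeff_refineStep] at hμ'
      by_cases hex : ∃ m ∈ Q.support.filter (fun m => ¬ IsUnit (Q.coeff m)), ∃ i, m + Finsupp.single i 1 = μ'
      · obtain ⟨m, hm, i, hi⟩ := hex
        obtain ⟨hms, hnu⟩ := Finset.mem_filter.mp hm
        have := hdeg m hms hnu
        have hd : (m + Finsupp.single i 1).degree = m.degree + 1 := by
          rw [Finsupp.degree_eq_sum, Finsupp.degree_eq_sum, Fin.sum_univ_three, Fin.sum_univ_three]
          simp only [Finsupp.add_apply, Finsupp.single_apply]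
          fin_cases i <;> simp <;> omega
        rw [← hi, hd]
        omega
      · exfalso
        push Not at hex
        have hsum : (∑ m ∈ Q.support.filter (fun m => ¬ IsUnit (Q.coeff m)),
            ∑ i, if m + Finsupp.single i 1 = μ' then b m i else 0) = 0 := by
          refine Finset.sum_eq_zero fun m hm => Finset.sum_eq_zero fun i _ => ?_
          rw [if_neg (hex m hm i)]
        rw [coeff_refineStep, hsum, add_zero] at hnu'
        rw [hsum, add_zero] at hμ'
        split_ifs at hnu' hμ' with h
        · exact hnu' h
        · exact hμ' rfl
    obtain ⟨G, hGu, hGrem, hGM⟩ := ih Q' (by rw [hev]; exact hQ) (by rw [hcoeff]; exact hu) hnpQ' hdegQ'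
    exact ⟨G, hGu, hGrem, by rw [hGM, hcoeff]⟩

include hgenr in
/-- **Unit representative protecting `M₀`**: if `g ≡ Q(c) mod 𝔪^K`, `Q_{M₀}` is a unit and `M₀`
has no predecessor in `supp Q`, then `g` has a unit representative modulo `𝔪^K` whose support
contains `M₀` (with the same coefficient). [cite: CossartJannsenSaito2020, Ch. 7 (7.3); proof of Lemma 14.8] -/
theorem exists_unitRep_mem_support {g : R} {K : ℕ} {Q : MvPolynomial (Fin 3) R}
    (hQ : g - eval c Q ∈ maximalIdeal R ^ K) {M₀ : Fin 3 →₀ ℕ} (hu : IsUnit (Q.coeff M₀))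
    (hnp : ∀ m ∈ Q.support, ¬ IsPred m M₀) :
    ∃ G : MvPolynomial (Fin 3) R, HasUnitCoeffs G ∧ g - eval c G ∈ maximalIdeal R ^ K ∧
      G.coeff M₀ = Q.coeff M₀ :=
  exists_unitRep_mem_support_aux c hgenr K Q hQ hu hnp (fun m _ _ => by omega)

end Refine

end Literature.AlgebraicGeometry.Resolution
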